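import Mathlib
import Summits.ValiantsHypothesis.ValiantsHypothesis.Theorems.DivisionGapPerMultiplesHardRelDenseHostAux
import Summits.ValiantsHypothesis.ValiantsHypothesis.Theorems.DivisionGapPerMultiplesHardSpreadPatternsRel
import Summits.ValiantsHypothesis.ValiantsHypothesis.Theorems.DivisionGapPerMultiplesHardStubSpreadCaptureRel
import Summits.ValiantsHypothesis.ValiantsHypothesis.Theorems.DivisionGapPerMultiplesHardStubBregmanFibre
import Summits.ValiantsHypothesis.ValiantsHypothesis.Theorems.DivisionGapPerMultiplesHardStubLogFactorialJensen
import Summits.ValiantsHypothesis.ValiantsHypothesis.Theorems.DivisionGapPerMultiplesHardStubStirlingGamma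
import Summits.ValiantsHypothesis.ValiantsHypothesis.Theorems.DivisionGapPerMultiplesHardDensePerHardReg
import Summits.ValiantsHypothesis.ValiantsHypothesis.Theorems.DivisionGapPerMultiplesHardStubSpreadRigidity
import Literature.Combinatorics.Enumerative.BregmanMinc
import Literature.Computability.AlgebraicComplexity.ArithCircuitProofs
import Literature.Computability.AlgebraicComplexity.PermanentIrreducible

/-!
# `DivisionGap.PerMultiplesHard` (stmt-ValiantsHypothesis-5068), line `uncharged-face-walk`:
stub `stub_relDenseHost` — the CONDITIONAL dense-host kill

Let `Y ⊆ [n]²` be a bipartite host (cells `(row, column)`; a permutation `π` is INSIDE `Y` when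
`(π j, j) ∈ Y` for every column `j`) containing an `f`-regular spanning subgraph `Y'` (`f ≥ 1`)
and satisfying the upper mixing bound `e_Y(A, B) ≤ β · #A · #B + ε · n²` (`0 < β ≤ 1`,
`0 ≤ ε ≤ 1`).  Let `ζ` be a row shift and `g ∈ ℝ≥0[x_ij]` a torus-homogeneous polynomial with
all rows hit such that EVERY permutation inside `Y` carries a `ζ`-spread probe in `supp g`.  Then,
GIVEN van der Waerden's permanent bound (`m ! ≤ m^m · per A` for doubly stochastic `A`, the first
hypothesis),

  `f^n · 5^{⌊n/10⌋} ≤ L(g) · (β n)^n · 4^{⌊n/10⌋} · exp (15 ε n / β + (log n + 12) / β)`.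

Proof chain (all ingredients are tree theorems of the line).
* `P := PM(Y)`.  The relative spread engine (`SpreadPatternsRel.stub_spreadPatternsRel`) gives a
  typed rectangle `(S, T)`, `n < 5 #S ≤ 2n`, with `#P ≤ L(g) · #Pc`, `Pc` the compatible part of
  `P` (all of `P` is probed).
* van der Waerden (`DensePerHardReg.pow_mul_factorial_le_of_vdW` on `Y'`) gives
  `f^n · n! ≤ n^n · #PM(Y') ≤ n^n · #P`, so `P ≠ ∅`, `Pc ≠ ∅`, and
  `SpreadCaptureRel.card_bounds_of_compatible` gives `#S ≤ 2 #T`, `#T ≤ 2 #S`; hence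
  `n < 10 u`, `5 u ≤ 4 n` for `u := #T`.
* A maximising fibre `{π ∈ P : π(T) = U}` over the valid images `U` (`Finset.exists_max_image`)
  and `SpreadCaptureRel.card_compatible_le` give `#Pc ≤ C(2 #S, u) · #Fib(U)`.
* Brégman–Minc (`BregmanFibre.stub_bregmanFibre`): `#Fib(U) ≤ ∏_j (D_j !)^{1/D_j}` with the
  column degrees `D_j` of `Y` into `U` (`j ∈ T`) resp. `Uᶜ` (`j ∉ T`); all `D_j ≥ 1` since the
  fibre is nonempty (`BregmanFibre.image_apply_subset_degSet`); double counting
  (`RelDenseHostAux.sum_degT`, `RelDenseHostAux.sum_degC`) and the mixing hypothesis bound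
  `Σ_{j ∈ T} D_j = e_Y(U, T)` and `Σ_{j ∉ T} D_j = e_Y(Uᶜ, Tᶜ)`.
* The analytic half (`RelDenseHostAux.fib_le`: Jensen at the level `max (e/u + 1) ⌈β u⌉₊`,
  Stirling from both sides, `log (1 + x) ≤ x`) turns this into
  `#Fib(U) ≤ β^n · u! · (n-u)! · exp (15 ε n/β + (log n + 12)/β)`.
* Finally `C(2 #S, u) · u! · (n-u)! · 5^{⌊n/10⌋} ≤ 4^{⌊n/10⌋} · n!`
  (`SpreadRigidity.descFactorial_mul_five_pow_le`) and cancellation of `n! > 0`.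
-/

noncomputable section

-- `Summit.ValiantsHypothesis.ValiantsHypothesis.…` is the tree's mandated layout (Sub = Summit).
set_option linter.dupNamespace false

namespace Summit.ValiantsHypothesis.ValiantsHypothesis.Theorems.DivisionGap.PerMultiplesHard.RelDenseHost

open MvPolynomial Literature.Computability.AlgebraicComplexity
open scoped NNReal BigOperators

/-! ### The stub -/

/-- **stub_relDenseHost — the CONDITIONAL dense-host kill.**  Hypotheses: van der Waerden's
permanent bound (spelled out: `m ! ≤ m^m · per A` for every doubly stochastic real `A`); a host
`Y ⊆ [n]²` (`n ≥ 5`) containing an `f`-regular spanning subgraph `Y'` (`f ≥ 1`); the upper mixing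
bound `e_Y(A, B) ≤ β · #A · #B + ε · n²` (`0 < β ≤ 1`, `0 ≤ ε ≤ 1`); a row shift `ζ` and a
torus-homogeneous `g` with all rows hit such that every permutation inside `Y` carries a
`ζ`-spread probe in `supp g`.  Conclusion:
`f^n · 5^{⌊n/10⌋} ≤ L(g) · (β n)^n · 4^{⌊n/10⌋} · exp (15 ε n/β + (log n + 12)/β)`.
Proof: `P := PM(Y)`; `SpreadPatternsRel.stub_spreadPatternsRel` gives a window `(S, T)` with
`#P ≤ L · #Pc` (all of `P` is probed); `DensePerHardReg.pow_mul_factorial_le_of_vdW` gives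
`f^n · n! ≤ n^n · #PM(Y') ≤ n^n · #P`, so `Pc ≠ ∅` and
`SpreadCaptureRel.card_bounds_of_compatible` gives `n < 10 u`, `5 u ≤ 4 n` (`u := #T`);
a maximising fibre and `SpreadCaptureRel.card_compatible_le` give `#Pc ≤ C(2 #S, u) · #Fib(U)`;
the fibre is nonempty, so all Brégman degrees are `≥ 1`
(`BregmanFibre.image_apply_subset_degSet`), and `BregmanFibre.stub_bregmanFibre` with
`RelDenseHostAux.fib_le` (double counting `RelDenseHostAux.sum_degT`, `RelDenseHostAux.sum_degC`
+ mixing; Jensen and Stirling inside) gives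
`#Fib(U) ≤ β^n u! (n-u)! exp (15 ε n/β + (log n + 12)/β)`; finally
`C(2 #S, u) u! (n-u)! 5^{⌊n/10⌋} ≤ 4^{⌊n/10⌋} n!` (`SpreadRigidity.descFactorial_mul_five_pow_le`)
and `n! > 0` is cancelled. [folklore] -/
theorem stub_relDenseHost :
    (∀ (m : ℕ) (A : Matrix (Fin m) (Fin m) ℝ), (∀ i j, 0 ≤ A i j) →
      (∀ i, ∑ j, A i j = 1) → (∀ j, ∑ i, A i j = 1) →
      (m.factorial : ℝ) ≤ (m : ℝ) ^ m * A.permanent) →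
    ∀ n ≥ 5, ∀ (Y Y' : Finset (Fin n × Fin n)) (f : ℕ), Y' ⊆ Y → 1 ≤ f →
      (∀ i : Fin n, (Finset.univ.filter fun j : Fin n => (i, j) ∈ Y').card = f) →
      (∀ j : Fin n, (Finset.univ.filter fun i : Fin n => (i, j) ∈ Y').card = f) →
      ∀ (β ε : ℝ), 0 < β → β ≤ 1 → 0 ≤ ε → ε ≤ 1 →
      (∀ A B : Finset (Fin n),
        ((Y.filter fun e => e.1 ∈ A ∧ e.2 ∈ B).card : ℝ) ≤
          β * A.card * B.card + ε * (n : ℝ) ^ 2) →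
      ∀ (ζ : Equiv.Perm (Fin n)) (g : MvPolynomial (Fin n × Fin n) ℝ≥0) (R C : Fin n → ℕ),
        (∀ m ∈ g.support, (∀ i, ∑ j, m (i, j) = R i) ∧ (∀ j, ∑ i, m (i, j) = C j)) →
        (∀ i, R i ≠ 0) →
        (∀ π : Equiv.Perm (Fin n), (∀ j, (π j, j) ∈ Y) →
          ∃ M ∈ g.support, ∀ e ∈ M.support, π e.2 = e.1 ∨ π e.2 = ζ e.1) →
        (f : ℝ) ^ n * (5 : ℝ) ^ (n / 10) ≤
          (complexity g : ℝ) * (β * n) ^ n * (4 : ℝ) ^ (n / 10) *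
            Real.exp (15 * ε * n / β + (Real.log n + 12) / β) := by
  classical
  intro hvdW n hn Y Y' f hY'Y hf hrow hcol β ε hβ hβ1 hε hε1 hmix ζ g R C hg hR hprobe
  -- (a) the comparison set `P = PM(Y)` and the relative spread engine
  set P : Finset (Equiv.Perm (Fin n)) :=
    (Finset.univ : Finset (Equiv.Perm (Fin n))).filter fun π : Equiv.Perm (Fin n) =>
      ∀ j, (π j, j) ∈ Y with hP
  have hPY : ∀ π ∈ P, ∀ j, (π j, j) ∈ Y := fun π hπ => (Finset.mem_filter.mp hπ).2
  obtain ⟨S, T, hlo, hhi, hcap⟩ :=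
    SpreadPatternsRel.stub_spreadPatternsRel n hn ζ g R C hg hR P
  -- all of `P` is probed: `#P ≤ L(g) · #Pc`
  have hcapP := (Finset.card_le_card fun π hπ =>
    Finset.mem_filter.mpr ⟨hπ, hprobe π (hPY π hπ)⟩).trans hcap
  -- (b) van der Waerden: `f^n · n! ≤ n^n · #PM(Y') ≤ n^n · #P`
  have hPM : ((Finset.univ : Finset (Equiv.Perm (Fin n))).filter
      (fun σ => ∀ i, (σ i, i) ∈ Y')).card ≤ P.card := by
    refine Finset.card_le_card fun σ hσ => ?_
    rw [Finset.mem_filter] at hσ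
    exact Finset.mem_filter.mpr ⟨hσ.1, fun j => hY'Y (hσ.2 j)⟩
  have h1 : f ^ n * n.factorial ≤ n ^ n * P.card :=
    (DensePerHardReg.pow_mul_factorial_le_of_vdW hvdW Y' hf hrow hcol).trans
      (Nat.mul_le_mul_left _ hPM)
  have hf0 : 0 < f := hf
  have hLHSpos : 0 < f ^ n * n.factorial := by positivity
  -- (c) a compatible permutation exists; the size constraints
  have hPcne : (P.filter fun π => (∀ i ∈ S, π.symm i ∈ T ∨ π.symm (ζ i) ∈ T) ∧
      (∀ j ∈ T, π j ∈ S ∨ ∃ i ∈ S, ζ i = π j)).Nonempty := by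
    apply Finset.card_pos.mp
    apply Nat.pos_of_ne_zero
    intro h0
    have h2 : P.card ≤ 0 :=
      calc P.card ≤ _ := hcapP
        _ = 0 := by rw [h0, mul_zero]
    have h3 : f ^ n * n.factorial ≤ 0 :=
      calc f ^ n * n.factorial ≤ n ^ n * P.card := h1
        _ = 0 := by rw [Nat.le_zero.mp h2, mul_zero]
    exact absurd h3 (not_le.mpr hLHSpos)
  obtain ⟨π₀, hπ₀⟩ := hPcne
  obtain ⟨-, ha, hb⟩ := Finset.mem_filter.mp hπ₀
  obtain ⟨hk2u, hu2k⟩ := SpreadCaptureRel.card_bounds_of_compatible ζ S T π₀ ha hb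
  obtain ⟨hUW₀, hUcard₀, -⟩ := SpreadCaptureRel.image_valid_of_compatible ζ S T π₀ ha hb
  have hun : T.card ≤ n := by
    have := T.card_le_univ
    rwa [Fintype.card_fin] at this
  have h10u : n < 10 * T.card := by omega
  have h5u : 5 * T.card ≤ 4 * n := by omega
  have hfu : n / 10 ≤ T.card := by omega
  have hab : 5 * (2 * S.card) ≤ 4 * n := by omega
  -- (d) the maximising fibre
  obtain ⟨U, hUV, hUmax⟩ := Finset.exists_max_image ((S ∪ S.image ⇑ζ).powersetCard T.card)
    (fun U => (P.filter fun π : Equiv.Perm (Fin n) => T.image ⇑π = U).card)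
    ⟨T.image ⇑π₀, Finset.mem_powersetCard.mpr ⟨hUW₀, hUcard₀⟩⟩
  obtain ⟨hUW, hUu⟩ := Finset.mem_powersetCard.mp hUV
  have h3 : (P.filter fun π => (∀ i ∈ S, π.symm i ∈ T ∨ π.symm (ζ i) ∈ T) ∧
      (∀ j ∈ T, π j ∈ S ∨ ∃ i ∈ S, ζ i = π j)).card ≤
      (2 * S.card).choose T.card *
        (P.filter fun π : Equiv.Perm (Fin n) => T.image ⇑π = U).card :=
    SpreadCaptureRel.card_compatible_le ζ S T P _ fun U' hU'W hU'c =>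
      hUmax U' (Finset.mem_powersetCard.mpr ⟨hU'W, hU'c⟩)
  -- the fibre in Brégman's form
  have hFU : (P.filter fun π : Equiv.Perm (Fin n) => T.image ⇑π = U) =
      ((Finset.univ : Finset (Equiv.Perm (Fin n))).filter fun π : Equiv.Perm (Fin n) =>
        (∀ j, (π j, j) ∈ Y) ∧ T.image ⇑π = U) := by
    rw [hP, Finset.filter_filter]
  rw [hFU] at h3
  -- (e) the counting chain in `ℕ`
  have hchain : f ^ n * n.factorial ≤ n ^ n * (complexity g * ((2 * S.card).choose T.card *
      ((Finset.univ : Finset (Equiv.Perm (Fin n))).filter fun π : Equiv.Perm (Fin n) =>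
        (∀ j, (π j, j) ∈ Y) ∧ T.image ⇑π = U).card)) :=
    h1.trans (Nat.mul_le_mul_left _ (hcapP.trans (Nat.mul_le_mul_left _ h3)))
  -- the fibre is nonempty
  have hFne : (((Finset.univ : Finset (Equiv.Perm (Fin n))).filter fun π : Equiv.Perm (Fin n) =>
      (∀ j, (π j, j) ∈ Y) ∧ T.image ⇑π = U)).Nonempty := by
    apply Finset.card_pos.mp
    apply Nat.pos_of_ne_zero
    intro h0
    rw [h0, mul_zero, mul_zero, mul_zero] at hchain
    exact absurd hchain (not_le.mpr hLHSpos)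
  obtain ⟨π, hπ⟩ := hFne
  -- (f) Brégman degrees are `≥ 1`; double counting and mixing
  have hdeg : ∀ j, 1 ≤ (if j ∈ T then U.filter (fun i => (i, j) ∈ Y)
      else Uᶜ.filter (fun i => (i, j) ∈ Y)).card := fun j =>
    Finset.card_pos.mpr ⟨π j, BregmanFibre.image_apply_subset_degSet n Y T U j
      (Finset.mem_image_of_mem (fun σ => σ j) hπ)⟩
  have hUc : Uᶜ.card = Tᶜ.card := by rw [Finset.card_compl, Finset.card_compl, hUu]
  have hTsum : ((∑ j ∈ T, (if j ∈ T then U.filter (fun i => (i, j) ∈ Y)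
      else Uᶜ.filter (fun i => (i, j) ∈ Y)).card : ℕ) : ℝ) ≤
      β * T.card * T.card + ε * (n : ℝ) ^ 2 := by
    rw [RelDenseHostAux.sum_degT]
    have h := hmix U T
    rwa [hUu] at h
  have hCsum : ((∑ j ∈ Tᶜ, (if j ∈ T then U.filter (fun i => (i, j) ∈ Y)
      else Uᶜ.filter (fun i => (i, j) ∈ Y)).card : ℕ) : ℝ) ≤
      β * Tᶜ.card * Tᶜ.card + ε * (n : ℝ) ^ 2 := by
    rw [RelDenseHostAux.sum_degC]
    have h := hmix Uᶜ Tᶜ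
    rwa [hUc] at h
  have hfib := RelDenseHostAux.fib_le T β ε _ (fun j => (if j ∈ T then U.filter (fun i => (i, j) ∈ Y)
      else Uᶜ.filter (fun i => (i, j) ∈ Y)).card) hβ hβ1 hε hε1
    (BregmanFibre.stub_bregmanFibre n Y T U) hdeg hTsum hCsum h10u h5u
  -- (g) the numerical inequality `C(2k, u) · u! · (n-u)! · 5^{n/10} ≤ 4^{n/10} · n!`
  have hnum : (2 * S.card).choose T.card * (T.card.factorial * (n - T.card).factorial) *
      5 ^ (n / 10) ≤ 4 ^ (n / 10) * n.factorial := by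
    have key := SpreadRigidity.descFactorial_mul_five_pow_le (2 * S.card) n hab T.card (n / 10) hfu
    calc (2 * S.card).choose T.card * (T.card.factorial * (n - T.card).factorial) * 5 ^ (n / 10)
        = (2 * S.card).descFactorial T.card * 5 ^ (n / 10) * (n - T.card).factorial := by
          rw [Nat.descFactorial_eq_factorial_mul_choose]; ring
      _ ≤ 4 ^ (n / 10) * n.descFactorial T.card * (n - T.card).factorial :=
          Nat.mul_le_mul_right _ key
      _ = 4 ^ (n / 10) * n.factorial := by
          rw [← Nat.factorial_mul_descFactorial hun]; ring
  -- (h) assemble over `ℝ` and cancel `n! > 0`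
  have hnf : (0 : ℝ) < n.factorial := by exact_mod_cast n.factorial_pos
  have hchainR : (f : ℝ) ^ n * n.factorial ≤ (n : ℝ) ^ n * ((complexity g : ℝ) *
      (((2 * S.card).choose T.card : ℝ) *
        ((((Finset.univ : Finset (Equiv.Perm (Fin n))).filter fun π : Equiv.Perm (Fin n) =>
          (∀ j, (π j, j) ∈ Y) ∧ T.image ⇑π = U).card : ℕ) : ℝ))) := by
    exact_mod_cast hchain
  have hnumR : ((2 * S.card).choose T.card : ℝ) * ((T.card.factorial : ℝ) *
      ((n - T.card).factorial : ℝ)) * (5 : ℝ) ^ (n / 10) ≤ (4 : ℝ) ^ (n / 10) * n.factorial := by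
    exact_mod_cast hnum
  refine le_of_mul_le_mul_right ?_ hnf
  calc (f : ℝ) ^ n * (5 : ℝ) ^ (n / 10) * n.factorial
      = (f : ℝ) ^ n * n.factorial * (5 : ℝ) ^ (n / 10) := by ring
    _ ≤ (n : ℝ) ^ n * ((complexity g : ℝ) * (((2 * S.card).choose T.card : ℝ) *
        ((((Finset.univ : Finset (Equiv.Perm (Fin n))).filter fun π : Equiv.Perm (Fin n) =>
          (∀ j, (π j, j) ∈ Y) ∧ T.image ⇑π = U).card : ℕ) : ℝ))) * (5 : ℝ) ^ (n / 10) :=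
        mul_le_mul_of_nonneg_right hchainR (by positivity)
    _ ≤ (n : ℝ) ^ n * ((complexity g : ℝ) * (((2 * S.card).choose T.card : ℝ) *
        (β ^ n * ((T.card.factorial : ℝ) * ((n - T.card).factorial : ℝ)) *
          Real.exp (15 * ε * n / β + (Real.log n + 12) / β)))) * (5 : ℝ) ^ (n / 10) := by
        gcongr
    _ = (complexity g : ℝ) * (β ^ n * (n : ℝ) ^ n) *
          Real.exp (15 * ε * n / β + (Real.log n + 12) / β) *
        (((2 * S.card).choose T.card : ℝ) * ((T.card.factorial : ℝ) *
          ((n - T.card).factorial : ℝ)) * (5 : ℝ) ^ (n / 10)) := by ring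
    _ ≤ (complexity g : ℝ) * (β ^ n * (n : ℝ) ^ n) *
          Real.exp (15 * ε * n / β + (Real.log n + 12) / β) *
        ((4 : ℝ) ^ (n / 10) * n.factorial) :=
        mul_le_mul_of_nonneg_left hnumR (by positivity)
    _ = _ := by rw [mul_pow]; ring

end Summit.ValiantsHypothesis.ValiantsHypothesis.Theorems.DivisionGap.PerMultiplesHard.RelDenseHost

end
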